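import Summits.ResolutionOfSingularities.ResolutionOfSingularities.Theorems.UniversalCellsCampaignW82DiagonalCriterionLemmas
import Literature.AlgebraicGeometry.Resolution.RegularImpliesSmooth
import Mathlib.RingTheory.LocalRing.ResidueField.Fiber
import HarnessLib

/-!
# [OURS · L1 W8.2] THE DIAGONAL (SELF-PRODUCT) CRITERION OF SMOOTHNESS over ANY field `K`: a finite type `K`-algebra
# `A` is `K`-smooth at `𝔭` iff `A ⊗_K A` is regular at the diagonal point over `𝔭`; `A` is smooth iff `A ⊗_K A` is
# a regular ring

Cell `res-hironaka` (run/shared/lean/pub/res-hironaka/), LADDER-RESOLUTION rung L (RESCUE), slot W8.2; host route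
`UniversalCells`, host item `PrimeFieldToPerfect` (stmt-ResolutionOfSingularities-15233), door 1. Proofs file
(Theses-free), written by res-L1-s82-pv-1 (gen 6). This is form (E5) of Cruxes/PrimeFieldToPerfect/KERNEL.md §2
(«diagonal form: for `Y` regular separated of finite type over `K`, `Y` smooth/`K` ⟺ `Y ×_K Y` is regular at the
points of the diagonal»), kernel-checked in affine form and for EVERY base field `K` — no perfectness of constants, no
`p`-rank hypothesis, no separatedness, and «`Y` regular» is a CONSEQUENCE, not a hypothesis. Forms (E3)/(E4) of the
same list (`…RegularTwistCriterion`, `…KunzTwistCriterion`, gen 5) needed `K = M(t)` with `M` perfect for the smooth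
direction; (E5) does not. For `A` of finite type over `K`, `𝔭 ⊂ A` prime, `𝔓 = μ⁻¹(𝔭) ⊂ A ⊗_K A` the DIAGONAL prime
over it (`μ` = multiplication, Mathlib `Algebra.TensorProduct.lmul'`):

* `isRegularLocalRing_quotient_localization_diagonal` — the section lemma (`…DiagonalCriterionLemmas` §1) for
  `A_𝔭 → (A ⊗_K A)_𝔓` (first factor) and the retraction induced by `μ`: `(A ⊗_K A)_𝔓` regular ⇒ its fibre ring
  `(A ⊗_K A)_𝔓 ⧸ 𝔭` regular.
* **`isSmoothAt_of_isRegularLocalRing_localization_diagonal`** — `(A ⊗_K A)_𝔓` regular ⇒ `A` is `K`-smooth at `𝔭`: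
  the regular fibre ring is the local ring of the fibre `κ(𝔭) ⊗_K A` of the first projection at its `κ(𝔭)`-RATIONAL
  point over `𝔭` (Mathlib `Ideal.Fiber.localizationAlgEquivQuotient`), where regular ⇒ smooth (Stacks 00TV, residue
  field `κ(𝔭)` itself), and smoothness at a point descends along `κ(𝔭) ⊇ K` (`…Lemmas` §3).
* **`isRegularLocalRing_localization_diagonal_of_isSmoothAt`** — the converse (base change of smoothness to
  `A ⊗_K A` over `A`; `K → A_𝔭 → (A ⊗_K A)_𝔓` formally smooth; smooth over a field ⇒ regular);
  **`isSmoothAt_iff_isRegularLocalRing_localization_diagonal`**.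
* **`smooth_iff_isRegularRing_tensor_self`** — GLOBAL FORM: `A` is smooth over `K` iff `A ⊗_K A` is a regular ring.

Nearest printed statements: EGA IV₄ 17.12.3–17.12.5 (smoothness of `f` along a section ⟺ the section is a
quasi-regular immersion; differential smoothness ⟺ `pr₂ : X ×_Y X → X` smooth along the diagonal) and Altman–Kleiman
VII §5–6; the regular-local-ring form here (no differentials, no quasi-regularity, any field) is recorded as folklore.
READING for slot W8.2 (links leaf `…DiagonalCriterionLinks`): the residual «some Frobenius twist `X₀^{(p^e)}` has a
SMOOTH proper birational model `Y`» reads «… has a proper birational model `Y` with `Y ×_{M(t)} Y` REGULAR (along the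
diagonal)», and the same for the ORIGINAL kernel `SmoothTwist p` over finitely generated `K` of any `p`-rank.

HONEST FRAMING. OURS theorems (classical algebraic geometry assembled from the tree: Matsumura 14.2, Stacks
00TV/00TF/038X/02VL); they replace the role of no printed item of [Hironaka2017] and are NOT statements of the
manuscript; nothing is attributed to its author. A normal form, not progress on the open residual. AI work, weaker than
expert review; no claim beyond the kernel. No `sorry`, no new axioms.

## References (locators only)
* A. Grothendieck, *EGA IV₄*, Publ. Math. IHÉS 32 (1967), 17.12.3–17.12.5.
* A. Altman, S. Kleiman, *Introduction to Grothendieck Duality Theory*, LNM 146 (1970), VII §5–6.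
* H. Matsumura, *Commutative Ring Theory* (1986), Thm. 14.2. [Matsumura1987]
* The Stacks Project, Tags 00TV, 00TF, 038X, 02VL. [StacksProject]
-/

noncomputable section

set_option linter.dupNamespace false -- mandated namespace of this single-conjunct summit

open IsLocalRing TensorProduct
open Literature.AlgebraicGeometry.Resolution

namespace Summit.ResolutionOfSingularities.ResolutionOfSingularities.Theorems.CampaignW82

universe u



/-! ## §4 The diagonal point of `A ⊗_K A` over `𝔭` and its fibre ring -/

section Diagonal

variable (K : Type u) [Field K] (A : Type u) [CommRing A] [Algebra K A]

/-- The diagonal prime `μ⁻¹(𝔭) ⊂ A ⊗_K A` (`μ` the multiplication) lies over `𝔭` for the LEFT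
`A`-algebra structure of `A ⊗_K A`. [folklore] -/
theorem comap_algebraMap_comap_lmul' (𝔭 : Ideal A) :
    (Ideal.comap (Algebra.TensorProduct.lmul' K (S := A)) 𝔭).comap (algebraMap A (A ⊗[K] A)) = 𝔭 := by
  ext a
  simp only [Ideal.mem_comap, Algebra.TensorProduct.algebraMap_apply, Algebra.algebraMap_self,
    RingHom.id_apply, Algebra.TensorProduct.lmul'_apply_tmul, mul_one]

/-- … and over `𝔭` for the RIGHT factor as well. [folklore] -/
theorem comap_includeRight_comap_lmul' (𝔭 : Ideal A) :
    (Ideal.comap (Algebra.TensorProduct.lmul' K (S := A)) 𝔭).comap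
      (Algebra.TensorProduct.includeRight (R := K) (A := A) : A →ₐ[K] A ⊗[K] A).toRingHom = 𝔭 := by
  ext a
  simp only [Ideal.mem_comap, AlgHom.toRingHom_eq_coe, RingHom.coe_coe,
    Algebra.TensorProduct.includeRight_apply, Algebra.TensorProduct.lmul'_apply_tmul, one_mul]

/-- **The fibre ring of the first projection at the diagonal point is regular.** For `A` Noetherian,
`𝔭 ⊂ A` prime and `𝔓 = μ⁻¹(𝔭)` the diagonal prime of `C = A ⊗_K A` over it: if `C_𝔓` is a regular
local ring then so is `C_𝔓 ⧸ 𝔭 C_𝔓` — the section lemma for `A_𝔭 → C_𝔓` (first factor) and its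
retraction induced by the multiplication `μ : C → A`. [folklore] -/
theorem isRegularLocalRing_quotient_localization_diagonal [IsNoetherianRing A] (𝔭 : Ideal A)
    [𝔭.IsPrime] (𝔓 : Ideal (A ⊗[K] A)) [𝔓.IsPrime]
    (h𝔓 : 𝔓 = Ideal.comap (Algebra.TensorProduct.lmul' K (S := A)) 𝔭)
    [IsRegularLocalRing (Localization.AtPrime 𝔓)] :
    IsRegularLocalRing
      (Localization.AtPrime 𝔓 ⧸ 𝔭.map (algebraMap A (Localization.AtPrime 𝔓))) := by
  set C := A ⊗[K] A with hC
  let μ : C →+* A := (Algebra.TensorProduct.lmul' K (S := A)).toRingHom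
  have h₁ : 𝔭 = 𝔓.comap (algebraMap A C) := by rw [h𝔓, comap_algebraMap_comap_lmul']
  have h₂ : 𝔓 = 𝔭.comap μ := by rw [h𝔓]; rfl
  let i : Localization.AtPrime 𝔭 →+* Localization.AtPrime 𝔓 :=
    Localization.localRingHom 𝔭 𝔓 (algebraMap A C) h₁
  let r : Localization.AtPrime 𝔓 →+* Localization.AtPrime 𝔭 := Localization.localRingHom 𝔓 𝔭 μ h₂
  have hμ : ∀ a : A, μ (algebraMap A C a) = a := fun a => by
    change Algebra.TensorProduct.lmul' K (S := A) (algebraMap A (A ⊗[K] A) a) = a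
    rw [Algebra.TensorProduct.algebraMap_apply, Algebra.algebraMap_self, RingHom.id_apply,
      Algebra.TensorProduct.lmul'_apply_tmul, mul_one]
  have hri : r.comp i = RingHom.id (Localization.AtPrime 𝔭) := by
    refine IsLocalization.ringHom_ext 𝔭.primeCompl ?_
    ext a
    change r (i (algebraMap A (Localization.AtPrime 𝔭) a)) = algebraMap A (Localization.AtPrime 𝔭) a
    rw [Localization.localRingHom_to_map, Localization.localRingHom_to_map, hμ]
  have hreg : IsRegularLocalRing (Localization.AtPrime 𝔓 ⧸ (maximalIdeal (Localization.AtPrime 𝔭)).map i) :=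
    isRegularLocalRing_quotient_map_maximalIdeal_of_comp_eq_id i r hri
  have hmap : (maximalIdeal (Localization.AtPrime 𝔭)).map i =
      𝔭.map (algebraMap A (Localization.AtPrime 𝔓)) := by
    rw [← Localization.AtPrime.map_eq_maximalIdeal, Ideal.map_map]
    congr 1
    rw [IsScalarTower.algebraMap_eq A C (Localization.AtPrime 𝔓)]
    exact IsLocalization.map_comp _
  exact @IsRegularLocalRing.of_ringEquiv _ _ hreg _ _ (Ideal.quotEquivOfEq hmap)

/-! ## §5 The criterion: `A` is `K`-smooth at `𝔭` iff `(A ⊗_K A)_{μ⁻¹ 𝔭}` is regular -/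

/-- **Regularity of the self-product at the diagonal point implies smoothness** (the diagonal
criterion, direction ⇐): `A` of finite type over a field `K`, `𝔭 ⊂ A` a prime, `𝔓 = μ⁻¹(𝔭)` the
diagonal prime of `A ⊗_K A` over it. If `(A ⊗_K A)_𝔓` is a regular local ring, then `A` is
`K`-smooth at `𝔭`. PROOF. The section lemma makes the fibre ring `(A ⊗_K A)_𝔓 ⧸ 𝔭` of the first
projection regular; it is the local ring of the fibre `κ(𝔭) ⊗_K A` at its `κ(𝔭)`-RATIONAL point over
`𝔭` (Mathlib `Ideal.Fiber.localizationAlgEquivQuotient`), where regular ⇒ smooth (Stacks 00TV, the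
residue field being `κ(𝔭)` itself); and smoothness at a point descends along the field extension
`κ(𝔭) ⊇ K` (`isSmoothAt_of_isSmoothAt_baseChange_field`). Classical (the differential proof reads:
`Ω_{A/K} ⊗ κ(𝔭) = 𝔓/𝔓²`-modulo-`𝔭` is spanned by `dim` elements); stated in EGA IV₄ 17.12.x only in
the smooth-diagonal direction — we record it as folklore. [folklore] -/
theorem isSmoothAt_of_isRegularLocalRing_localization_diagonal [Algebra.FiniteType K A]
    (𝔭 : Ideal A) [𝔭.IsPrime] (𝔓 : Ideal (A ⊗[K] A)) [𝔓.IsPrime]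
    (h𝔓 : 𝔓 = Ideal.comap (Algebra.TensorProduct.lmul' K (S := A)) 𝔭)
    [IsRegularLocalRing (Localization.AtPrime 𝔓)] : Algebra.IsSmoothAt K 𝔭 := by
  classical
  haveI : IsNoetherianRing A := Algebra.FiniteType.isNoetherianRing K A
  haveI hAfp : Algebra.FinitePresentation K A :=
    (Algebra.FinitePresentation.of_finiteType (R := K) (A := A)).mp inferInstance
  set C := A ⊗[K] A with hC
  let κ := 𝔭.ResidueField
  -- the `κ(𝔭)`-rational point `q'` of the fibre `κ(𝔭) ⊗_A C` over the diagonal point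
  let μ : C →ₐ[A] A := Algebra.TensorProduct.lmul'' K
  let ψ : C →ₐ[A] κ := (Algebra.ofId A κ).comp μ
  let ev : 𝔭.Fiber C →ₐ[κ] κ :=
    Algebra.TensorProduct.lift (AlgHom.id κ κ) ψ (fun _ _ => Commute.all _ _)
  let q' : Ideal (𝔭.Fiber C) := RingHom.ker ev.toRingHom
  haveI hq' : q'.IsPrime := RingHom.ker_isPrime _
  have hev : ∀ x : C, ev ((1 : κ) ⊗ₜ[A] x) = algebraMap A κ (Algebra.TensorProduct.lmul' K (S := A) x) := by
    intro x
    change Algebra.TensorProduct.lift (AlgHom.id κ κ) ψ (fun _ _ => Commute.all _ _) ((1 : κ) ⊗ₜ[A] x) = _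
    rw [Algebra.TensorProduct.lift_tmul, map_one, one_mul]
    rfl
  have hq'𝔓 : q'.comap (Algebra.TensorProduct.includeRight : C →ₐ[A] 𝔭.Fiber C) = 𝔓 := by
    ext x
    rw [Ideal.mem_comap, h𝔓, Ideal.mem_comap]
    change ev ((1 : κ) ⊗ₜ[A] x) = 0 ↔ _
    rw [hev, Ideal.algebraMap_residueField_eq_zero]
  -- Step 1: the local ring of the fibre at `q'` is regular (section lemma)
  haveI : IsRegularLocalRing (Localization.AtPrime q') := by
    subst hq'𝔓
    letI := Localization.AtPrime.algebraOfLiesOver 𝔭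
      (q'.comap (Algebra.TensorProduct.includeRight : C →ₐ[A] 𝔭.Fiber C))
    haveI hreg := isRegularLocalRing_quotient_localization_diagonal K A 𝔭
      (q'.comap (Algebra.TensorProduct.includeRight : C →ₐ[A] 𝔭.Fiber C)) h𝔓
    exact IsRegularLocalRing.of_ringEquiv (Ideal.Fiber.localizationAlgEquivQuotient 𝔭 q').toRingEquiv.symm
  -- Step 2: the fibre is `κ(𝔭)`-smooth at its rational point `q'` (Stacks 00TV)
  -- (the `κ(𝔭)`-algebra structure on the residue field is the composite one, `ResidueField.algebra`,
  -- as in the statement of `isSmoothAt_of_isRegularLocalRing_of_formallySmooth_residueField`)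
  have hfs := formallySmooth_residueField_localization_ker ev
  haveI : Algebra.FinitePresentation A C := inferInstance
  haveI : Algebra.FinitePresentation κ (𝔭.Fiber C) := inferInstance
  have hsm : Algebra.IsSmoothAt κ q' :=
    isSmoothAt_of_isRegularLocalRing_of_formallySmooth_residueField κ (𝔭.Fiber C) q' (h𝕜 := hfs)
  -- Step 3: transport to `κ(𝔭) ⊗_K A` and descend along `K → κ(𝔭)`
  let e : κ ⊗[A] C ≃ₐ[κ] κ ⊗[K] A := Algebra.TensorProduct.cancelBaseChange K A κ κ A
  let Q : Ideal (κ ⊗[K] A) := q'.comap e.symm.toRingEquiv.toRingHom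
  haveI : Q.IsPrime := Ideal.comap_isPrime _ q'
  haveI : Algebra.IsSmoothAt κ Q :=
    isSmoothAt_of_algEquiv e q' Q (by
      ext x
      change x ∈ q' ↔ e.symm (e x) ∈ q'
      rw [AlgEquiv.symm_apply_apply])
  have h := isSmoothAt_of_isSmoothAt_baseChange_field K A κ Q
  have hQ : Q.comap (Algebra.TensorProduct.includeRight (R := K) (A := κ) :
      A →ₐ[K] κ ⊗[K] A).toRingHom = 𝔭 := by
    ext a
    simp only [Ideal.mem_comap, AlgHom.toRingHom_eq_coe, RingHom.coe_coe,
      Algebra.TensorProduct.includeRight_apply, Q]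
    change e.symm ((1 : κ) ⊗ₜ[K] a) ∈ q' ↔ _
    rw [Algebra.TensorProduct.cancelBaseChange_symm_tmul]
    change ev ((1 : κ) ⊗ₜ[A] ((1 : A) ⊗ₜ[K] a)) = 0 ↔ _
    rw [hev, Ideal.algebraMap_residueField_eq_zero, Algebra.TensorProduct.lmul'_apply_tmul, one_mul]
  have key : ∀ (I J : Ideal A) [I.IsPrime] [J.IsPrime], I = J →
      Algebra.IsSmoothAt K I → Algebra.IsSmoothAt K J := by
    rintro I J _ _ rfl hI
    exact hI
  exact key _ _ hQ h

/-- **Smoothness implies regularity of the self-product at the diagonal point** (direction ⇒):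
if `A` (finite type over the field `K`) is `K`-smooth at `𝔭`, then `(A ⊗_K A)_{μ⁻¹ 𝔭}` is a
regular local ring: `A ⊗_K A` is `A`-smooth at `𝔓 = μ⁻¹ 𝔭` (base change), so `K → A_𝔭 → (A ⊗_K A)_𝔓`
is formally smooth, and smooth over a field is regular. [folklore] -/
theorem isRegularLocalRing_localization_diagonal_of_isSmoothAt [Algebra.FiniteType K A]
    (𝔭 : Ideal A) [𝔭.IsPrime] [Algebra.IsSmoothAt K 𝔭] (𝔓 : Ideal (A ⊗[K] A)) [𝔓.IsPrime]
    (h𝔓 : 𝔓 = Ideal.comap (Algebra.TensorProduct.lmul' K (S := A)) 𝔭) :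
    IsRegularLocalRing (Localization.AtPrime 𝔓) := by
  classical
  haveI hAfp : Algebra.FinitePresentation K A :=
    (Algebra.FinitePresentation.of_finiteType (R := K) (A := A)).mp inferInstance
  set C := A ⊗[K] A with hC
  haveI : Algebra.FinitePresentation K C := Algebra.FinitePresentation.trans K A C
  have h₁ : 𝔓.comap (algebraMap A C) = 𝔭 := by rw [h𝔓, comap_algebraMap_comap_lmul']
  haveI : 𝔓.LiesOver 𝔭 := ⟨h₁.symm⟩
  -- `C` is `A`-smooth at `𝔓` by base change
  haveI hA : Algebra.IsSmoothAt A 𝔓 :=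
    isSmoothAt_baseChange (R := K) (S := A) A 𝔭 𝔓 (by rw [h𝔓, comap_includeRight_comap_lmul'])
  -- `K → A_𝔭 → C_𝔓` is formally smooth
  letI := Localization.AtPrime.algebraOfLiesOver 𝔭 𝔓
  haveI : Algebra.FormallySmooth A (Localization.AtPrime 𝔓) := hA
  haveI : Algebra.FormallySmooth (Localization.AtPrime 𝔭) (Localization.AtPrime 𝔓) :=
    Algebra.FormallySmooth.localization_base 𝔭.primeCompl
  haveI : Algebra.FormallySmooth K (Localization.AtPrime 𝔭) := ‹Algebra.IsSmoothAt K 𝔭›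
  haveI : Algebra.IsSmoothAt K 𝔓 :=
    Algebra.FormallySmooth.comp K (Localization.AtPrime 𝔭) (Localization.AtPrime 𝔓)
  exact isRegularLocalRing_of_isSmoothAt K C 𝔓

/-- **The diagonal (self-product) criterion of smoothness over a field, pointwise**: for `A` of
finite type over a field `K` and a prime `𝔭`, `A` is `K`-smooth at `𝔭` iff the local ring of
`A ⊗_K A` at the diagonal prime `μ⁻¹(𝔭)` is regular. [folklore] -/
theorem isSmoothAt_iff_isRegularLocalRing_localization_diagonal [Algebra.FiniteType K A]
    (𝔭 : Ideal A) [𝔭.IsPrime] :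
    Algebra.IsSmoothAt K 𝔭 ↔
      IsRegularLocalRing (Localization.AtPrime (Ideal.comap (Algebra.TensorProduct.lmul' K (S := A)) 𝔭)) :=
  ⟨fun _ => isRegularLocalRing_localization_diagonal_of_isSmoothAt K A 𝔭 _ rfl,
    fun _ => isSmoothAt_of_isRegularLocalRing_localization_diagonal K A 𝔭 _ rfl⟩

/-! ## §6 Global form: `A` is smooth over `K` iff `A ⊗_K A` is a regular ring -/

/-- A smooth algebra over a field is a regular ring (its localizations at primes are formally smooth
over the field, hence regular, Stacks 00TV). [cite: StacksProject, Tag 00TV] -/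
theorem isRegularRing_of_smooth_of_field (B : Type u) [CommRing B] [Algebra K B] [Algebra.Smooth K B] :
    IsRegularRing B := by
  haveI : IsNoetherianRing B := Algebra.FiniteType.isNoetherianRing K B
  refine isRegularRing_iff.mpr fun p _ => ?_
  haveI : Algebra.FormallySmooth B (Localization.AtPrime p) :=
    Algebra.FormallySmooth.of_isLocalization p.primeCompl
  haveI : Algebra.IsSmoothAt K p := Algebra.FormallySmooth.comp K B (Localization.AtPrime p)
  exact isRegularLocalRing_of_isSmoothAt K B p

/-- **The self-product criterion of smoothness over a field, global form**: a finite type algebra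
`A` over a field `K` is smooth iff `A ⊗_K A` is a regular ring. (⇒: `A ⊗_K A` is smooth over `K`;
⇐: every localization at a diagonal prime is regular, so `A` is smooth at every prime.) [folklore] -/
theorem smooth_iff_isRegularRing_tensor_self [Algebra.FiniteType K A] :
    Algebra.Smooth K A ↔ IsRegularRing (A ⊗[K] A) := by
  classical
  haveI hAfp : Algebra.FinitePresentation K A :=
    (Algebra.FinitePresentation.of_finiteType (R := K) (A := A)).mp inferInstance
  constructor
  · intro h
    haveI : Algebra.Smooth A (A ⊗[K] A) := inferInstance
    haveI : Algebra.Smooth K (A ⊗[K] A) := Algebra.Smooth.comp K A (A ⊗[K] A)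
    exact isRegularRing_of_smooth_of_field K (A ⊗[K] A)
  · intro h
    have hloc : Algebra.smoothLocus K A = Set.univ := by
      refine Set.eq_univ_of_forall fun p => ?_
      change Algebra.IsSmoothAt K p.asIdeal
      haveI := h.isRegularLocalRing_localization (Ideal.comap (Algebra.TensorProduct.lmul' K (S := A)) p.asIdeal)
      exact isSmoothAt_of_isRegularLocalRing_localization_diagonal K A p.asIdeal _ rfl
    exact ⟨(Algebra.smoothLocus_eq_univ_iff.mp hloc), hAfp⟩

end Diagonal


end Summit.ResolutionOfSingularities.ResolutionOfSingularities.Theorems.CampaignW82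

end
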